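import Mathlib
import HarnessLib

/-!
# The dual of a quotient: `B^⊥ ≅ (A ⧸ B)^` (Deitmar–Echterhoff, Proposition 3.6.1 (a))

Topic `Topology/Algebra`; namespace `Literature.Topology.Algebra.QuotientDual`. For a group `A` with a topology
(no separation, local compactness or commutativity needed) and a normal subgroup `B`:

* `annihilator B ≤ PontryaginDual A` — the characters `χ` of `A` with `χ(B) = 1` (`B^⊥`);
* `inflate B : PontryaginDual (A ⧸ B) →ₜ* PontryaginDual A`, `ξ ↦ ξ ∘ (A → A ⧸ B)` — continuous, injective,
  with image exactly `B^⊥` (`range_inflate`);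
* `lift B χ hχ : PontryaginDual (A ⧸ B)` — the character `χ̃(xB) := χ(x)` of the quotient attached to
  `χ ∈ B^⊥` (`lift_mk`), inverse to `inflate` (`inflate_lift`, `lift_inflate`);
* `annihilatorEquiv B : annihilator B ≃* PontryaginDual (A ⧸ B)` — Proposition 3.6.1 (a) of
  Deitmar–Echterhoff as a group isomorphism: "`B^⊥` is isomorphic to `\widehat{A/B}` via `χ ↦ χ̃` with
  `χ̃(xB) = χ(x)`" [DeitmarEchterhoff2014, Prop. 3.6.1 (a)]. (The statement there is for LCA groups and
  includes bicontinuity; the algebraic isomorphism and the continuity of `inflate` need neither local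
  compactness nor commutativity of `A`, and are what is recorded here.)

Mathlib has the contravariant functor `PontryaginDual.map` and the Pontryagin dual's group / topology,
but no quotient API; the HodgeCM PerL cell (`pub-hodgecm`) builds the characters of its adelic-model tori
`[T] = T(𝔸) ⧸ T(L₀)` of prescribed central weight by exactly this lift (`KernelModelHeisenberg.χ₀`, `Xw`).
Filed under the LEAN-IN-TREE rule by seat pv15-g6.

## References

* A. Deitmar, S. Echterhoff, *Principles of Harmonic Analysis*, 2nd ed. (2014), §3.6, Proposition 3.6.1
  and Corollary 3.6.2 [DeitmarEchterhoff2014].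
-/

noncomputable section

open _root_.Topology

namespace Literature.Topology.Algebra

namespace QuotientDual

variable {A : Type*} [Group A] [TopologicalSpace A] (B : Subgroup A)

/-- **The annihilator** `B^⊥ := {χ ∈ Â : χ(B) = 1}`, a subgroup of the Pontryagin dual.
[cite: DeitmarEchterhoff2014, §3.6 (notation before Prop. 3.6.1)] -/
def annihilator : Subgroup (PontryaginDual A) where
  carrier := {χ | ∀ b ∈ B, χ b = 1}
  one_mem' := fun _ _ => rfl
  mul_mem' := by
    intro χ ψ hχ hψ b hb
    change χ b * ψ b = 1
    rw [hχ b hb, hψ b hb, one_mul]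
  inv_mem' := by
    intro χ hχ b hb
    change (χ b)⁻¹ = 1
    rw [hχ b hb, inv_one]

/-- Membership in the annihilator. [folklore] -/
theorem mem_annihilator {χ : PontryaginDual A} : χ ∈ annihilator B ↔ ∀ b ∈ B, χ b = 1 := Iff.rfl

variable [B.Normal]

/-- The quotient map `A → A ⧸ B` as a continuous homomorphism. [folklore] -/
def mkHom : A →ₜ* A ⧸ B where
  toMonoidHom := QuotientGroup.mk' B
  continuous_toFun := QuotientGroup.continuous_mk

/-- Unfolding of `mkHom`. [folklore] -/
@[simp] theorem mkHom_apply (a : A) : mkHom B a = (a : A ⧸ B) := rfl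

/-- **Inflation** `(A ⧸ B)^ → Â`, `ξ ↦ ξ ∘ mk` — a continuous homomorphism (`PontryaginDual.map` of the
quotient map). [folklore] -/
def inflate : PontryaginDual (A ⧸ B) →ₜ* PontryaginDual A := PontryaginDual.map (mkHom B)

/-- Unfolding of `inflate`. [folklore] -/
@[simp] theorem inflate_apply (ξ : PontryaginDual (A ⧸ B)) (a : A) : inflate B ξ a = ξ (a : A ⧸ B) := rfl

/-- Inflated characters kill `B`. [folklore] -/
theorem inflate_mem_annihilator (ξ : PontryaginDual (A ⧸ B)) : inflate B ξ ∈ annihilator B := by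
  intro b hb
  rw [inflate_apply, (QuotientGroup.eq_one_iff b).mpr hb, map_one]

/-- Inflation is injective (the quotient map is onto). [folklore] -/
theorem inflate_injective : Function.Injective (inflate B) := by
  intro ξ η h
  apply PontryaginDual.ext
  intro q
  obtain ⟨a, rfl⟩ := QuotientGroup.mk_surjective q
  have := congrArg (fun χ : PontryaginDual A => χ a) h
  simpa only [inflate_apply] using this

/-- **The lift** `χ̃ ∈ (A ⧸ B)^` of a character `χ ∈ B^⊥`: `χ̃(xB) := χ(x)`; continuity through the quotient
map. [cite: DeitmarEchterhoff2014, Prop. 3.6.1 (a)] -/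
def lift (χ : PontryaginDual A) (hχ : χ ∈ annihilator B) : PontryaginDual (A ⧸ B) where
  toMonoidHom := QuotientGroup.lift B (χ : A →ₜ* Circle).toMonoidHom fun b hb => by
    rw [MonoidHom.mem_ker]
    exact hχ b hb
  continuous_toFun := by
    change Continuous fun q : A ⧸ B =>
      QuotientGroup.lift B (χ : A →ₜ* Circle).toMonoidHom (fun b hb => by
        rw [MonoidHom.mem_ker]; exact hχ b hb) q
    rw [(QuotientGroup.isQuotientMap_mk B).continuous_iff]
    exact (χ : A →ₜ* Circle).continuous

/-- `χ̃(xB) = χ(x)`. [cite: DeitmarEchterhoff2014, Prop. 3.6.1 (a)] -/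
@[simp] theorem lift_mk (χ : PontryaginDual A) (hχ : χ ∈ annihilator B) (a : A) :
    lift B χ hχ (a : A ⧸ B) = χ a := rfl

/-- Inflating the lift gives back `χ`. [folklore] -/
theorem inflate_lift (χ : PontryaginDual A) (hχ : χ ∈ annihilator B) : inflate B (lift B χ hχ) = χ :=
  PontryaginDual.ext fun _ => rfl

/-- Lifting an inflated character gives it back. [folklore] -/
theorem lift_inflate (ξ : PontryaginDual (A ⧸ B)) :
    lift B (inflate B ξ) (inflate_mem_annihilator B ξ) = ξ := by
  apply PontryaginDual.ext
  intro q
  obtain ⟨a, rfl⟩ := QuotientGroup.mk_surjective q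
  rfl

/-- The image of inflation is exactly the annihilator `B^⊥` — the identification `\widehat{A/B} = B^⊥`
inside `Â` of Prop. 3.6.1 (a) (which is also the "kernel `\widehat{A/B}`" clause of Cor. 3.6.2).
[cite: DeitmarEchterhoff2014, Prop. 3.6.1 (a)] -/
theorem range_inflate : Set.range (inflate B) = (annihilator B : Set (PontryaginDual A)) := by
  ext χ
  constructor
  · rintro ⟨ξ, rfl⟩
    exact inflate_mem_annihilator B ξ
  · intro hχ
    exact ⟨lift B χ hχ, inflate_lift B χ hχ⟩

/-- **Deitmar–Echterhoff, Proposition 3.6.1 (a)**: `B^⊥ ≅ (A ⧸ B)^` via `χ ↦ χ̃`, `χ̃(xB) = χ(x)`, with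
inverse the inflation `ξ ↦ ξ ∘ mk` (as an isomorphism of groups).
[cite: DeitmarEchterhoff2014, Prop. 3.6.1 (a)] -/
def annihilatorEquiv : annihilator B ≃* PontryaginDual (A ⧸ B) where
  toFun χ := lift B χ χ.2
  invFun ξ := ⟨inflate B ξ, inflate_mem_annihilator B ξ⟩
  left_inv χ := Subtype.ext (inflate_lift B χ χ.2)
  right_inv ξ := lift_inflate B ξ
  map_mul' χ ψ := by
    apply PontryaginDual.ext
    intro q
    obtain ⟨a, rfl⟩ := QuotientGroup.mk_surjective q
    rfl

/-- Unfolding of `annihilatorEquiv`. [folklore] -/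
@[simp] theorem annihilatorEquiv_apply_mk (χ : annihilator B) (a : A) :
    annihilatorEquiv B χ (a : A ⧸ B) = (χ : PontryaginDual A) a := rfl

/-- Unfolding of the inverse of `annihilatorEquiv`. [folklore] -/
@[simp] theorem annihilatorEquiv_symm_apply (ξ : PontryaginDual (A ⧸ B)) :
    ((annihilatorEquiv B).symm ξ : PontryaginDual A) = inflate B ξ := rfl

end QuotientDual

end Literature.Topology.Algebra

end
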